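import Summits.Schanuel.Schanuel.Theorems.ZilberEacParamSurfaceDictionary
import HarnessLib

/-!
# Polynomially parametrised base curves, XXV: EQUAL DEGREES with non-real leading ratio —
# every surface of Mantova–Masser's case over `{(g₀(t), g₁(t))}`, `deg g₀ = deg g₁ ≥ 2`,
# `lc(g₁)/lc(g₀) ∉ ℝ`

HONEST FRAMING.  Cell `pub-schanuel` (Zilber's Exponential-Algebraic Closedness, case ladder;
host summit Schanuel), seat 2, gen 20.  Bookkeeping: for `d = deg g₀ = deg g₁ = n ≥ 2` the phase
condition of file XXI reads `Re(lc(g₁) · i / lc(g₀)) ≠ 0`, i.e. `Im(lc(g₁)/lc(g₀)) ≠ 0` — exactly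
gen 19's hypothesis for two `y₁`-degrees (`unprojectedDensityQuestion_instance_paramSurface₃_of_eq`).
With the trichotomy of file XXII and the dictionary lemma of file XXIV:
**`unprojectedDense_of_mmCase_of_base_eq_paramCurve_of_eq`** — every `W ⊆ ℂ² × ℂ²` in
Mantova–Masser's case (dim-π-S-1-free) whose base curve is `{(g₀(t), g₁(t))}` with
`deg g₀ = deg g₁ ≥ 2` and `lc(g₁)/lc(g₀) ∉ ℝ` has Zariski-dense exponential points; e.g. every `W`
of the case over the curve `(x₁ - i x₀)² = x₀` (`g = (t², i t² + t)`).  What stays OPEN (equal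
degrees): real irrational leading ratio (the real-line technology of gens 10–18 along a curved
base), rational ratio (unimodular reduction to unequal degrees), vanishing phase for unequal
degrees; general algebraic base curves; Fib(3,2); EC(3,2).  Mantova–Masser's question is OPEN in
general (PLMS 2024 §1 p. 5); NOT Schanuel's conjecture (neither used nor implied; EAC ⇏ SC).
-/

noncomputable section

open Complex MvPolynomial
open Literature.NumberTheory.Transcendental Literature.ModelTheory.Zilber
open Literature.ModelTheory.ExponentialFields

set_option linter.dupNamespace false

namespace Summit.Schanuel.Schanuel.Theorems

section EqualDegrees

variable (g₀ g₁ : Polynomial ℂ) {Q : MvPolynomial (Fin 3) ℂ}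

/-- For equal degrees the phase condition of file XXI is `Im(lc(g₁)/lc(g₀)) ≠ 0`. -/
theorem phase_of_eq_of_im_ne_zero (hd : 2 ≤ g₀.natDegree) (heq : g₁.natDegree = g₀.natDegree)
    (him : (g₁.leadingCoeff / g₀.leadingCoeff).im ≠ 0) :
    ¬ g₀.natDegree ∣ g₁.natDegree ∨
      (g₁.leadingCoeff * (I / g₀.leadingCoeff) ^ (g₁.natDegree / g₀.natDegree)).re ≠ 0 := by
  refine Or.inr ?_
  rw [heq, Nat.div_self (by omega), pow_one,
    show g₁.leadingCoeff * (I / g₀.leadingCoeff) = g₁.leadingCoeff / g₀.leadingCoeff * I by ring,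
    Complex.mul_I_re]
  exact neg_ne_zero.2 him

/-- **Complete theorem, equal degrees with non-real leading ratio.**  `deg g₀ = deg g₁ ≥ 2`,
`Im(lc(g₁)/lc(g₀)) ≠ 0`; `Q ∈ ℂ[t, y₀, y₁]` irreducible with a zero in `(ℂˣ)²` over infinitely many
`t` ⟹ `S(g; Q)` is in Mantova–Masser's case AND its exponential points are Zariski dense.
[cite: MantovaMasser2023, §1 Further remarks, p. 5 (the question, open in general)] (new) -/
theorem unprojectedDensityQuestion_paramSurface₃_complete_of_eq (hd : 2 ≤ g₀.natDegree)
    (heq : g₁.natDegree = g₀.natDegree) (him : (g₁.leadingCoeff / g₀.leadingCoeff).im ≠ 0)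
    (hirr : Irreducible Q)
    (hfib : Set.Infinite {t : ℂ | ∃ c : Fin 2 → ℂ, c 0 ≠ 0 ∧ c 1 ≠ 0 ∧
      MvPolynomial.eval ![t, c 0, c 1] Q = 0}) :
    MMCaseDimPiOneFree {w : Fin 2 ⊕ Fin 2 → ℂ | ∃ t : ℂ, w (Sum.inl 0) = g₀.eval t ∧
        w (Sum.inl 1) = g₁.eval t ∧
        MvPolynomial.eval (Fin.cases t (fun i => w (Sum.inr i)) : Fin 3 → ℂ) Q = 0} ∧
      UnprojectedDense {w : Fin 2 ⊕ Fin 2 → ℂ | ∃ t : ℂ, w (Sum.inl 0) = g₀.eval t ∧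
        w (Sum.inl 1) = g₁.eval t ∧
        MvPolynomial.eval (Fin.cases t (fun i => w (Sum.inr i)) : Fin 3 → ℂ) Q = 0} := by
  rcases two_y1_degrees_or_y0_of_torusFibres hirr hfib with h2 | ⟨hQ2, h1⟩
  · exact unprojectedDensityQuestion_instance_paramSurface₃_of_eq g₀ g₁ hd heq him hirr h2 hfib
  · exact unprojectedDensityQuestion_instance_paramSurface₃_of_y0 g₀ g₁ hd (by omega)
      (phase_of_eq_of_im_ne_zero g₀ g₁ hd heq him) hirr hQ2 h1
      (fibreRoots_infinite_of_torusFibres hQ2 hfib)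

/-- **LITERAL CAPSTONE, equal degrees.**  Every `W ⊆ ℂ² × ℂ²` in Mantova–Masser's case
(dim-π-S-1-free) whose base curve is `{(g₀(t), g₁(t))}` with `deg g₀ = deg g₁ ≥ 2` and
`lc(g₁)/lc(g₀) ∉ ℝ` has Zariski-dense exponential points.
[cite: MantovaMasser2023, §1 Further remarks, p. 5 (the question, open in general)] (new) -/
theorem unprojectedDense_of_mmCase_of_base_eq_paramCurve_of_eq (hd : 2 ≤ g₀.natDegree)
    (heq : g₁.natDegree = g₀.natDegree) (him : (g₁.leadingCoeff / g₀.leadingCoeff).im ≠ 0)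
    {W : Set (Fin 2 ⊕ Fin 2 → ℂ)} (hmm : MMCaseDimPiOneFree W)
    (hbase : zeroLocus ℂ (vanishingIdeal ℂ (projAdd '' (W ∩ torusLocus ℂ 2))) =
      {x : Fin 2 → ℂ | ∃ t : ℂ, x 0 = g₀.eval t ∧ x 1 = g₁.eval t}) :
    UnprojectedDense W := by
  obtain ⟨Q, hQ, hfib, rfl⟩ := exists_eq_paramSurface₃_of_mmCase g₀ g₁ (by omega) hmm hbase
  exact (unprojectedDensityQuestion_paramSurface₃_complete_of_eq g₀ g₁ hd heq him hQ hfib).2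

/-- **The three literal capstones in one statement.**  Base curve `{(g₀(t), g₁(t))}` with
`deg g₀, deg g₁ ≥ 2` and ONE of: `deg g₀ < deg g₁` with the phase condition of file XXI;
`deg g₁ < deg g₀` with the mirrored phase condition; `deg g₀ = deg g₁` with non-real leading ratio
⟹ every `W` of Mantova–Masser's case over it has Zariski-dense exponential points.
[cite: MantovaMasser2023, §1 Further remarks, p. 5 (the question, open in general)] (new) -/
theorem unprojectedDense_of_mmCase_of_base_eq_paramCurve_all (hd₀ : 2 ≤ g₀.natDegree)
    (hd₁ : 2 ≤ g₁.natDegree)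
    (h : (g₀.natDegree < g₁.natDegree ∧ (¬ g₀.natDegree ∣ g₁.natDegree ∨
        (g₁.leadingCoeff * (I / g₀.leadingCoeff) ^ (g₁.natDegree / g₀.natDegree)).re ≠ 0)) ∨
      (g₁.natDegree < g₀.natDegree ∧ (¬ g₁.natDegree ∣ g₀.natDegree ∨
        (g₀.leadingCoeff * (I / g₁.leadingCoeff) ^ (g₀.natDegree / g₁.natDegree)).re ≠ 0)) ∨
      (g₁.natDegree = g₀.natDegree ∧ (g₁.leadingCoeff / g₀.leadingCoeff).im ≠ 0))
    {W : Set (Fin 2 ⊕ Fin 2 → ℂ)} (hmm : MMCaseDimPiOneFree W)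
    (hbase : zeroLocus ℂ (vanishingIdeal ℂ (projAdd '' (W ∩ torusLocus ℂ 2))) =
      {x : Fin 2 → ℂ | ∃ t : ℂ, x 0 = g₀.eval t ∧ x 1 = g₁.eval t}) :
    UnprojectedDense W := by
  rcases h with ⟨hlt, hph⟩ | ⟨hgt, hph⟩ | ⟨heq, him⟩
  · exact unprojectedDense_of_mmCase_of_base_eq_paramCurve g₀ g₁ hd₀ hlt hph hmm hbase
  · exact unprojectedDense_of_mmCase_of_base_eq_paramCurve_of_gt g₀ g₁ hd₁ hgt hph hmm hbase
  · exact unprojectedDense_of_mmCase_of_base_eq_paramCurve_of_eq g₀ g₁ hd₀ heq him hmm hbase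

end EqualDegrees

/-! ## Example: every surface of the case over `(x₁ - i x₀)² = x₀` -/

/-- The curve `(x₁ - i x₀)² = x₀` is `{(t², i t² + t)}`. -/
theorem iQuadratic_eq_paramCurve :
    {x : Fin 2 → ℂ | (x 1 - I * x 0) ^ 2 = x 0} =
      {x : Fin 2 → ℂ | ∃ t : ℂ, x 0 = (Polynomial.X ^ 2 : Polynomial ℂ).eval t ∧
        x 1 = (Polynomial.C I * Polynomial.X ^ 2 + Polynomial.X : Polynomial ℂ).eval t} := by
  ext x
  simp only [Set.mem_setOf_eq, Polynomial.eval_pow, Polynomial.eval_X, Polynomial.eval_add,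
    Polynomial.eval_mul, Polynomial.eval_C]
  constructor
  · intro h
    exact ⟨x 1 - I * x 0, h.symm, by rw [h]; ring⟩
  · rintro ⟨t, h0, h1⟩
    rw [h1, h0]; ring

/-- `deg (i X² + X) = 2`. -/
theorem natDegree_C_I_mul_X_sq_add_X :
    (Polynomial.C I * Polynomial.X ^ 2 + Polynomial.X : Polynomial ℂ).natDegree = 2 := by
  rw [Polynomial.natDegree_add_eq_left_of_natDegree_lt] <;>
    simp [Polynomial.natDegree_C_mul_X_pow 2 I I_ne_zero]

/-- `lc (i X² + X) = i`. -/
theorem leadingCoeff_C_I_mul_X_sq_add_X :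
    (Polynomial.C I * Polynomial.X ^ 2 + Polynomial.X : Polynomial ℂ).leadingCoeff = I := by
  rw [Polynomial.leadingCoeff, natDegree_C_I_mul_X_sq_add_X]
  simp [Polynomial.coeff_X]

/-- **Every `W` of Mantova–Masser's case whose base curve is `(x₁ - i x₀)² = x₀` has Zariski-dense
exponential points** (equal degrees `2 = 2`, leading ratio `i ∉ ℝ`).
[cite: MantovaMasser2023, §1 Further remarks, p. 5 (the question, open in general)] (new) -/
theorem unprojectedDense_of_mmCase_of_base_eq_iQuadratic {W : Set (Fin 2 ⊕ Fin 2 → ℂ)}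
    (hmm : MMCaseDimPiOneFree W)
    (hbase : zeroLocus ℂ (vanishingIdeal ℂ (projAdd '' (W ∩ torusLocus ℂ 2))) =
      {x : Fin 2 → ℂ | (x 1 - I * x 0) ^ 2 = x 0}) :
    UnprojectedDense W := by
  rw [iQuadratic_eq_paramCurve] at hbase
  refine unprojectedDense_of_mmCase_of_base_eq_paramCurve_of_eq (Polynomial.X ^ 2)
    (Polynomial.C I * Polynomial.X ^ 2 + Polynomial.X) (by simp)
    (by rw [natDegree_C_I_mul_X_sq_add_X]; simp) ?_ hmm hbase
  rw [leadingCoeff_C_I_mul_X_sq_add_X]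
  simp

end Summit.Schanuel.Schanuel.Theorems
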